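import Mathlib.LinearAlgebra.Matrix.ToLin
import Mathlib.LinearAlgebra.FiniteDimensional.Lemmas
import Literature.NumberTheory.EllipticCurves.WeilPairingProofs
import Literature.NumberTheory.EllipticCurves.MazurTorsion
import HarnessLib

/-!
# Mazur 1977, Ch. III §5, p. 157: the Galois module `E[N]` of a curve with a rational point of
# prime order `N` — the extension (5.4) `0 → ℤ/N → E[N] → μ_N → 0`, the Borel shape
# `(1 *; 0 χ)` of `ρ̄_{E,N}`, and the `χ⁻¹`-twisted action (proofs)

Topic `Literature/NumberTheory/EllipticCurves`. Fifth sibling proof file (theorems only, no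
definitions, no named facts, no `sorry`) of the vocabulary file `MazurTorsion.lean`, serving the
prime-case leaf `Literature.NumberTheory.EllipticCurves.Mazur1977_no_prime_torsion W` (B. Mazur,
*Modular curves and the Eisenstein ideal*, Publ. Math. IHÉS 47 (1977), Ch. III §5, pp. 156–160).
Where `MazurTorsionLocalStepsProofs.lean` proves the LOCAL Steps 1–2 of the printed proof, this
file proves its opening GALOIS-THEORETIC paragraph (p. 157), the set-up of the Second and Third
reductions and of Step 4, for the putative curve "`ℤ/N ⊂ E`":

> "Let `K = ℚ(ζ_N)` … and let `L` be the field extension of `ℚ` generated by the `N`-division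
> points of `E`. By considering the short exact sequence of `Gal(ℚ̄/ℚ)`-modules
> (5.4) `0 → ℤ/N → E[N] → μ_N → 0` one sees that `Gal(L/ℚ)` has a faithful representation
> into `GL₂(𝔽_N)` of the form `(1 *; 0 χ)` where `χ : Gal(L/ℚ) → Gal(K/ℚ) ≅ 𝔽_N*` is the
> cyclotomic character. … Moreover, an elementary computation gives that the natural action of
> `Gal(K/ℚ)` on `Gal(L/K)` (conjugation in `Gal(L/ℚ)`) is by multiplication by `χ⁻¹`."

In the tree's vocabulary (`GaloisAction.lean`: the geometric `N`-torsion
`E[N] = WeierstrassCurve.geomTorsion W N ⊆ E(F̄)` with its `Γ_F`-action; `ModPGaloisRep.lean`: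
the mod-`N` cyclotomic character `χ̄_N = modPCyclotomicCharacterZMod F N`, `σ ζ = ζ^{χ̄_N(σ)}`),
over any perfect field `F` with `N ≠ char F` prime and for any non-zero `Γ_F`-fixed `P ∈ E[N]`:

* `smul_sub_cyclotomic_smul_mem_zmultiples` — **(5.4)**: `σ S - χ̄_N(σ) S ∈ ⟨P⟩` for all
  `σ ∈ Γ_F`, `S ∈ E[N]`; i.e. `⟨P⟩ ≅ ℤ/N` (trivial action) and `Γ_F` acts on `E[N]/⟨P⟩ ≅ ℤ/N`
  through `χ̄_N` (`≅ μ_N`): the Borel shape `(1 *; 0 χ)`. PROOF: `E[N]` is an `𝔽_N`-plane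
  (`#E[N] = N²`, tree `card_torsionPoints_eq_sq_holds`, *AEC* III.6.4(b)); in a frame
  `e : E[N] ≃ 𝔽_N²` with `e P = (1, 0)` (`exists_addEquiv_apply_eq_single`) the matrix of `σ`
  is `(1 b; 0 d)` with `d = det = χ̄_N(σ)` by **`det ρ̄_{E,N} = χ̄_N`**, the tree's
  `det_eq_modPCyclotomicCharacterZMod_of_exists_weilPairing` (Cornell–Silverman–Stevens II §7)
  fed with the PROVED Weil pairing `exists_weilPairing_holds` (`WeilPairingProofs.lean`,
  *AEC* III.8.1).
* `not_hasIrreducibleModPGaloisRep_of_smul_eq` — hence `ρ̄_{E,N}` is **reducible**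
  (`WeierstrassCurve.HasIrreducibleModPGaloisRep` fails: `⟨P⟩` is stable, `≠ ⊥`, `≠ ⊤`).
* `conj_smul_sub_eq_cyclotomic_inv_smul` — **the `χ⁻¹`-twisted action**, frame-free: for
  `τ ∈ Γ_F` with `χ̄_N(τ) = 1` (`τ ∈ Γ_K`) the "upper right entry" of `τ` is the map
  `S ↦ τ S - S` (values in `⟨P⟩`), and `(σ τ σ⁻¹) S - S = χ̄_N(σ)⁻¹ (τ S - S)` for all `σ ∈ Γ_F`
  (the matrix identity `(1 β; 0 d)(1 b; 0 1)(1 β; 0 d)⁻¹ = (1 d⁻¹b; 0 1)`).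
* `exists_stable_isCompl_zmultiples_iff` — **"(5.4) splits if and only if `L = K`"**: `⟨P⟩` has
  a `Γ_F`-stable complement in `E[N]` iff `Γ_K = ker χ̄_N` acts trivially on `E[N]` ((⇐): the
  image of `χ̄_N` is cyclic, generated by `χ̄_N(σ₀)`; the `χ̄_N(σ₀)`-eigenspace of `σ₀`, or any
  complement if `χ̄_N(σ₀) = 1`).
* Over `ℚ` (§3), for an elliptic curve with a rational point `P` of prime order `N`
  (`addOrderOf P = N`, the hypothesis negated by the leaf): the geometric point `P̄` of `P` is a
  non-zero `Γ_ℚ`-fixed element of `E[N]` (`exists_geomTorsion_of_addOrderOf_eq`, via Mathlib's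
  `Affine.Point.map` along `ℚ → ℚ̄`), so all of the above holds (`Mazur1977_torsion_galoisModule`),
  and `ρ̄_{E,N}` is reducible (`not_hasIrreducibleModPGaloisRep_of_addOrderOf_eq`; contrapositive
  `not_exists_addOrderOf_eq_of_hasIrreducibleModPGaloisRep`: irreducible `ρ̄_{E,N}` ⇒ no rational
  point of order `N`).

Not formalised here: the Second/Third reductions themselves (Shafarevich's theorem or
Thm. (4.1), `End_ℚ(E) = ℤ`; Herbrand's theorem).

## References

* [Mazur1977] B. Mazur, *Modular curves and the Eisenstein ideal*, Publ. Math. IHÉS 47 (1977),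
  Ch. III §5, p. 157 (held: `paper:doi-10-1007-bf02684339`, PDF p. 126; read).
* [SilvermanCSS1997] J. H. Silverman, in Cornell–Silverman–Stevens, *Modular Forms and Fermat's
  Last Theorem* (1997), Ch. II §7 Proposition (`det ρ̄_m = χ_m`), §8.
* [SilvermanAEC2009] J. H. Silverman, *The Arithmetic of Elliptic Curves*, 2nd ed. (2009),
  III.6.4(b), III.8.1.

## Design

No definitions; `noncomputable section`, `open scoped Classical`, as in `GaloisAction.lean`,
`WeilPairing.lean` and `MazurTorsion.lean`. The `𝔽_N`-structure on `E[N]` is Mathlib's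
`AddSubgroup.torsionBy.zmodModule`, introduced locally (`letI`) inside proofs only; statements use
`ℕ`-multiples `(χ̄_N σ).val • S`, as `modPCyclotomicCharacterZMod_spec` does.
-/

noncomputable section

open scoped Classical

universe u

namespace Literature.NumberTheory.EllipticCurves

open _root_.WeierstrassCurve Literature.NumberTheory.GaloisRepresentations Field

/-! ## §1 `E[N]` as an `𝔽_N`-plane; a frame through a given non-zero point -/

section Frame

variable {F : Type u} [Field F] (W : WeierstrassCurve F) [W.IsElliptic] (N : ℕ) [Fact N.Prime]
  [NeZero (N : F)]

omit [Fact N.Prime] in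
/-- `#E[N] = N²` for `N` invertible in `F` (Silverman, *AEC* III.6.4(b); the tree's
`card_torsionPoints_eq_sq_holds` over `F̄`). [cite: SilvermanAEC2009, Cor. III.6.4(b)] -/
theorem natCard_geomTorsion : Nat.card (geomTorsion W N) = N ^ 2 := by
  have hNF : ((N : ℕ) : AlgebraicClosure F) ≠ 0 := fun h0 ↦ NeZero.ne (N : F) <| by
    apply (algebraMap F (AlgebraicClosure F)).injective
    rw [map_natCast, map_zero, h0]
  exact card_torsionPoints_eq_sq_holds W (AlgebraicClosure F) hNF

omit [W.IsElliptic] [NeZero (N : F)] in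
/-- A non-zero element of `E[N]` (`N` prime) has order `N`. [folklore] -/
theorem addOrderOf_eq_of_ne_zero {P : geomTorsion W N} (hP : P ≠ 0) : addOrderOf P = N := by
  have hN : N.Prime := Fact.out
  have hNP : N • P = 0 := by
    apply Subtype.ext
    have h := (mem_torsionPoints_iff W (AlgebraicClosure F) (P : geomPoints W)).mp P.2
    rw [natCast_zsmul] at h
    exact h
  rcases (Nat.dvd_prime hN).mp (addOrderOf_dvd_of_nsmul_eq_zero hNP) with h1 | h
  · exact absurd (AddMonoid.addOrderOf_eq_one_iff.mp h1) hP
  · exact h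

/-- **A frame of `E[N] ≅ 𝔽_N²` through a non-zero point**: for `P ∈ E[N] ∖ {O}` there is an
additive isomorphism `e : E[N] ≃ (ℤ/N)²` with `e P = (1, 0)` (`E[N]` is an `𝔽_N`-plane by
`#E[N] = N²`; complete `P` to a basis). [folklore] -/
theorem exists_addEquiv_apply_eq_single {P : geomTorsion W N} (hP : P ≠ 0) :
    ∃ e : geomTorsion W N ≃+ (Fin 2 → ZMod N), e P = Pi.single 0 1 := by
  letI : Module (ZMod N) (geomTorsion W N) := AddSubgroup.torsionBy.zmodModule
  have hN : N.Prime := Fact.out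
  haveI : Finite (geomTorsion W N) :=
    finite_torsionPoints_holds W (AlgebraicClosure F) (n := (N : ℤ)) (by exact_mod_cast hN.ne_zero)
  haveI : Module.Finite (ZMod N) (geomTorsion W N) := Module.Finite.of_finite
  have hrank : Module.finrank (ZMod N) (geomTorsion W N) = 2 := by
    have h := Module.natCard_eq_pow_finrank (K := ZMod N) (V := geomTorsion W N)
    rw [natCard_geomTorsion W N, Nat.card_zmod] at h
    exact (Nat.pow_right_injective hN.two_le h).symm
  -- a vector outside the line through `P`
  have hlt : Submodule.span (ZMod N) ({P} : Set (geomTorsion W N)) < ⊤ := by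
    refine lt_top_iff_ne_top.mpr fun htop ↦ ?_
    have h1 := finrank_span_singleton (K := ZMod N) hP
    rw [htop, finrank_top, hrank] at h1
    exact absurd h1 (by norm_num)
  obtain ⟨Q, -, hQ⟩ := SetLike.exists_of_lt hlt
  have hli : LinearIndependent (ZMod N) ![P, Q] := by
    rw [LinearIndependent.pair_iff]
    intro s t hst
    by_cases ht : t = 0
    · subst ht
      rw [zero_smul, add_zero] at hst
      exact ⟨(smul_eq_zero.mp hst).resolve_right hP, rfl⟩
    · exfalso
      apply hQ
      have hQ' : Q = (-(t⁻¹ * s)) • P := by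
        have h := congrArg (fun R ↦ t⁻¹ • R) hst
        simp only [smul_add, smul_smul, inv_mul_cancel₀ ht, one_smul, smul_zero] at h
        rw [neg_smul, eq_neg_iff_add_eq_zero, add_comm]
        exact h
      rw [hQ']
      exact Submodule.smul_mem _ _ (Submodule.subset_span rfl)
  let b : Module.Basis (Fin 2) (ZMod N) (geomTorsion W N) :=
    basisOfLinearIndependentOfCardEqFinrank hli (by rw [hrank, Fintype.card_fin])
  have hb0 : b 0 = P := by
    change (basisOfLinearIndependentOfCardEqFinrank hli _) 0 = P
    rw [coe_basisOfLinearIndependentOfCardEqFinrank]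
    rfl
  refine ⟨b.equivFun.toAddEquiv, ?_⟩
  change b.equivFun P = _
  rw [← hb0]
  funext j
  rw [Module.Basis.equivFun_self, Pi.single_apply]
  simp only [eq_comm]

end Frame

/-! ## §2 The Borel shape `(1 *; 0 χ)` of `ρ̄_{E,N}` at a Galois-fixed point of order `N` -/

section Structure

variable {F : Type u} [Field F] [PerfectField F] (W : WeierstrassCurve F) [W.IsElliptic]
  (N : ℕ) [Fact N.Prime] [NeZero (N : F)]

/-- **Mazur 1977, Ch. III §5, (5.4): with a rational point of order `N`, `E[N]` is an extension
of `μ_N` by `ℤ/N`** (p. 157: "By considering the short exact sequence of `Gal(ℚ̄/ℚ)`-modules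
(5.4) `0 → ℤ/N → E[N] → μ_N → 0` one sees that `Gal(L/ℚ)` has a faithful representation into
`GL₂(𝔽_N)` of the form `(1 *; 0 χ)` where `χ` … is the cyclotomic character"). Over any perfect
field `F` with `N ≠ char F` prime: if `P ∈ E[N] ∖ {O}` is fixed by `Γ_F` (e.g. the image of an
`F`-rational point of order `N`), then for every `σ ∈ Γ_F` and `S ∈ E[N]`,
`σ S - χ̄_N(σ) S ∈ ⟨P⟩`, i.e. `Γ_F` acts on the quotient `E[N]/⟨P⟩ ≅ ℤ/N` through the mod-`N`
cyclotomic character `χ̄_N` (`Literature.NumberTheory.GaloisRepresentations.modPCyclotomicCharacterZMod`).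
Proof: in a frame `e : E[N] ≃ 𝔽_N²` with `e P = (1, 0)` the matrix of `σ` is `(1 b; 0 d)`, and
`d = det = χ̄_N(σ)` by **`det ρ̄_{E,N} = χ̄_N`** (Weil pairing; tree
`det_eq_modPCyclotomicCharacterZMod_of_exists_weilPairing` with the PROVED Weil pairing
`exists_weilPairing_holds`); then `σ(x, y) - d(x, y) = ((1 - d)x + by, 0)`.
[cite: Mazur1977, Ch. III §5, (5.4) and the display following it, p. 157; SilvermanCSS1997, Ch. II §7 Proposition (det ρ̄ = χ)] -/
theorem smul_sub_cyclotomic_smul_mem_zmultiples {P : geomTorsion W N} (hP0 : P ≠ 0)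
    (hP : ∀ σ : absoluteGaloisGroup F, σ • P = P) (σ : absoluteGaloisGroup F)
    (S : geomTorsion W N) :
    σ • S - ((modPCyclotomicCharacterZMod F N σ : (ZMod N)ˣ) : ZMod N).val • S ∈
      AddSubgroup.zmultiples P := by
  letI : Module (ZMod N) (geomTorsion W N) := AddSubgroup.torsionBy.zmodModule
  haveI : NeZero N := ⟨(Fact.out : N.Prime).ne_zero⟩
  obtain ⟨e, heP⟩ := exists_addEquiv_apply_eq_single W N hP0
  -- the matrix of `σ` in the frame `e`
  set M : Matrix (Fin 2) (Fin 2) (ZMod N) :=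
    Matrix.of fun i j ↦ e (σ • e.symm (Pi.single j 1)) i with hM
  have hMvec : ∀ T : geomTorsion W N, e (σ • T) = M.mulVec (e T) := by
    -- two `𝔽_N`-linear maps `𝔽_N² → 𝔽_N²` agreeing on the standard basis
    let f : (Fin 2 → ZMod N) →ₗ[ZMod N] (Fin 2 → ZMod N) :=
      (e.toAddMonoidHom.comp ((DistribSMul.toAddMonoidHom (geomTorsion W N) σ).comp
        e.symm.toAddMonoidHom)).toZModLinearMap N
    have hf : ∀ v, f v = e (σ • e.symm v) := fun _ ↦ rfl
    have hfg : f = Matrix.mulVecLin M := by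
      refine (Pi.basisFun (ZMod N) (Fin 2)).ext fun j ↦ ?_
      rw [Pi.basisFun_apply, hf, Matrix.mulVecLin_apply, Matrix.mulVec_single_one]
      funext i
      rw [hM, Matrix.col_apply, Matrix.of_apply]
    intro T
    have h := congrArg (fun g : (Fin 2 → ZMod N) →ₗ[ZMod N] (Fin 2 → ZMod N) ↦ g (e T)) hfg
    simp only [hf, Matrix.mulVecLin_apply, AddEquiv.symm_apply_apply] at h
    exact h
  have hdet := det_eq_modPCyclotomicCharacterZMod_of_exists_weilPairing W N
    (exists_weilPairing_holds W N) e σ M hMvec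
  -- the first column of `M` is `e (σ P) = e P = (1, 0)`
  have hcol : ∀ i, M i 0 = (Pi.single (0 : Fin 2) (1 : ZMod N) : Fin 2 → ZMod N) i := by
    intro i
    rw [hM, Matrix.of_apply, ← heP, e.symm_apply_apply, hP]
  have h00 : M 0 0 = 1 := by rw [hcol]; simp
  have h10 : M 1 0 = 0 := by rw [hcol]; simp
  rw [Matrix.det_fin_two, h00, h10, one_mul, mul_zero, sub_zero] at hdet
  -- `e (σ S - χ S) = ((1 - χ) x + b y) • (1, 0)`
  set χ : ZMod N := ((modPCyclotomicCharacterZMod F N σ : (ZMod N)ˣ) : ZMod N) with hχ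
  set c : ZMod N := (1 - χ) * e S 0 + M 0 1 * e S 1 with hc
  suffices h : σ • S - χ.val • S = c.val • P from
    AddSubgroup.mem_zmultiples_iff.mpr ⟨c.val, by rw [h, natCast_zsmul]⟩
  apply e.injective
  rw [map_sub, map_nsmul, map_nsmul, hMvec, heP]
  funext i
  rw [Pi.sub_apply, Pi.smul_apply, Pi.smul_apply, nsmul_eq_mul, nsmul_eq_mul,
    ZMod.natCast_zmod_val, ZMod.natCast_zmod_val]
  fin_cases i
  · simp [Matrix.mulVec, dotProduct, Fin.sum_univ_two, h00, hc]
    ring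
  · simp [Matrix.mulVec, dotProduct, Fin.sum_univ_two, h10, hdet, hχ]

omit [PerfectField F] in
/-- **`ρ̄_{E,N}` is reducible** when `E[N]` has a non-zero `Γ_F`-fixed point (in particular when
`E(F)` has a point of order `N`): the line `⟨P⟩ ≅ ℤ/N` is a `Γ_F`-stable subgroup of `E[N]`
other than `⊥` and `⊤` (`#E[N] = N² > N`). In Mazur's words, the representation has "the form
`(1 *; 0 χ)`". [cite: Mazur1977, Ch. III §5, p. 157 (display after (5.4))] -/
theorem not_hasIrreducibleModPGaloisRep_of_smul_eq {P : geomTorsion W N} (hP0 : P ≠ 0)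
    (hP : ∀ σ : absoluteGaloisGroup F, σ • P = P) : ¬ W.HasIrreducibleModPGaloisRep N := by
  have hN : N.Prime := Fact.out
  intro hirr
  have hstab : ∀ σ : absoluteGaloisGroup F, ∀ Q ∈ AddSubgroup.zmultiples P,
      σ • Q ∈ AddSubgroup.zmultiples P := by
    intro σ Q hQ
    obtain ⟨k, rfl⟩ := AddSubgroup.mem_zmultiples_iff.mp hQ
    rw [← DistribMulAction.toAddMonoidHom_apply, map_zsmul, DistribMulAction.toAddMonoidHom_apply,
      hP]
    exact AddSubgroup.mem_zmultiples_iff.mpr ⟨k, rfl⟩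
  rcases hirr (AddSubgroup.zmultiples P) hstab with h | h
  · exact hP0 ((AddSubgroup.eq_bot_iff_forall _).mp h P (AddSubgroup.mem_zmultiples P))
  · have hcard : Nat.card (AddSubgroup.zmultiples P) = Nat.card (geomTorsion W N) := by
      rw [h, AddSubgroup.card_top]
    rw [Nat.card_zmultiples, addOrderOf_eq_of_ne_zero W N hP0, natCard_geomTorsion W N, sq] at hcard
    exact absurd (mul_right_cancel₀ hN.ne_zero ((one_mul N).trans hcard)) hN.one_lt.ne

/-- **Mazur's "elementary computation": `Gal(K/ℚ)` acts on `Gal(L/K)` through `χ⁻¹`** (p. 157: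
"an elementary computation gives that the natural action of `Gal(K/ℚ)` on `Gal(L/K)` (conjugation
in `Gal(L/ℚ)`) is by multiplication by `χ⁻¹`. This computation uses the existence of the faithful
representation of `Gal(L/ℚ)` of the form `(1 *; 0 χ)`"; in matrices,
`(1 β; 0 d)(1 b; 0 1)(1 β; 0 d)⁻¹ = (1 d⁻¹b; 0 1)`). Frame-free form: for `τ ∈ Γ_F` with
`χ̄_N(τ) = 1` (i.e. `τ ∈ Γ_K`, `K = F(ζ_N)`) the "upper right entry" of `τ` is the nilpotent
endomorphism `S ↦ τ S - S` of `E[N]` (values in `⟨P⟩`), and for every `σ ∈ Γ_F`,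
`(σ τ σ⁻¹) S - S = χ̄_N(σ)⁻¹ (τ S - S)`. [cite: Mazur1977, Ch. III §5, p. 157] -/
theorem conj_smul_sub_eq_cyclotomic_inv_smul {P : geomTorsion W N} (hP0 : P ≠ 0)
    (hP : ∀ σ : absoluteGaloisGroup F, σ • P = P) {τ : absoluteGaloisGroup F}
    (hτ : modPCyclotomicCharacterZMod F N τ = 1) (σ : absoluteGaloisGroup F)
    (S : geomTorsion W N) :
    (σ * τ * σ⁻¹) • S - S =
      (((modPCyclotomicCharacterZMod F N σ)⁻¹ : (ZMod N)ˣ) : ZMod N).val • (τ • S - S) := by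
  have hN : N.Prime := Fact.out
  haveI : NeZero N := ⟨hN.ne_zero⟩
  -- `n T := τ T - T` takes values in `⟨P⟩`, kills `⟨P⟩`, and is additive
  have hn_mem : ∀ T : geomTorsion W N, τ • T - T ∈ AddSubgroup.zmultiples P := by
    intro T
    have h := smul_sub_cyclotomic_smul_mem_zmultiples W N hP0 hP τ T
    rwa [hτ, Units.val_one, ZMod.val_one, one_smul] at h
  have hn_fixed : ∀ (ρ : absoluteGaloisGroup F) (T : geomTorsion W N),
      ρ • (τ • T - T) = τ • T - T := by
    intro ρ T
    obtain ⟨k, hk⟩ := AddSubgroup.mem_zmultiples_iff.mp (hn_mem T)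
    rw [← hk, ← DistribMulAction.toAddMonoidHom_apply, map_zsmul,
      DistribMulAction.toAddMonoidHom_apply, hP]
  have hn_P : ∀ k : ℤ, τ • (k • P) - k • P = 0 := by
    intro k
    rw [← DistribMulAction.toAddMonoidHom_apply, map_zsmul, DistribMulAction.toAddMonoidHom_apply,
      hP, sub_self]
  -- `σ⁻¹ S = χ(σ⁻¹) S + k P`
  obtain ⟨k, hk⟩ := AddSubgroup.mem_zmultiples_iff.mp
    (smul_sub_cyclotomic_smul_mem_zmultiples W N hP0 hP σ⁻¹ S)
  have hinv : σ⁻¹ • S =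
      (((modPCyclotomicCharacterZMod F N σ)⁻¹ : (ZMod N)ˣ) : ZMod N).val • S + k • P := by
    rw [← map_inv, hk]
    abel
  -- assemble
  calc (σ * τ * σ⁻¹) • S - S
      = σ • (τ • (σ⁻¹ • S) - σ⁻¹ • S) := by
        simp only [smul_sub, smul_smul, mul_assoc, mul_inv_cancel, one_smul]
    _ = τ • (σ⁻¹ • S) - σ⁻¹ • S := hn_fixed σ (σ⁻¹ • S)
    _ = (((modPCyclotomicCharacterZMod F N σ)⁻¹ : (ZMod N)ˣ) : ZMod N).val • (τ • S - S) := by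
        rw [hinv, smul_add, add_sub_add_comm, hn_P k, add_zero,
          ← DistribMulAction.toAddMonoidHom_apply, map_nsmul, DistribMulAction.toAddMonoidHom_apply,
          ← nsmul_sub]

/-- **"It is clear that the exact sequence (5.4) splits if and only if `L = K`"** (Mazur, p. 157,
the sentence before the Second reduction; `L = F(E[N])`, `K = F(ζ_N)`). In the setting of
`smul_sub_cyclotomic_smul_mem_zmultiples`: (5.4) splits as a sequence of `Γ_F`-modules — i.e.
the line `⟨P⟩` has a `Γ_F`-stable complement `C` in `E[N]` — if and only if `Γ_K = ker χ̄_N`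
acts trivially on `E[N]` (i.e. `L ⊆ K`). PROOF. (⇒) For `τ ∈ Γ_K` and `c ∈ C`, `τ c - c` lies
in `C` and, by (5.4) with `χ̄_N(τ) = 1`, in `⟨P⟩`, hence is `0`; and `τ` fixes `⟨P⟩`. (⇐) The
image `χ̄_N(Γ_F) ≤ 𝔽_N^×` is cyclic, generated by `χ̄_N(σ₀)` say, and `Γ_F` then acts on `E[N]`
through the powers of `σ₀` (an element of `σ₀^{-i} σ` with `χ̄_N = 1` acts trivially). If
`d = χ̄_N(σ₀) ≠ 1` the `d`-eigenspace `C = {S : σ₀ S = d S}` of `σ₀` is a stable complement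
(`C ∩ ⟨P⟩ = 0` as `d ≠ 1`; `S - c P ∈ C` for `c = k/(1 - d)` where `σ₀ S = d S + k P`); if
`d = 1` then `Γ_F` acts trivially and any complement of the line will do.
[cite: Mazur1977, Ch. III §5, p. 157] -/
theorem exists_stable_isCompl_zmultiples_iff {P : geomTorsion W N} (hP0 : P ≠ 0)
    (hP : ∀ σ : absoluteGaloisGroup F, σ • P = P) :
    (∃ C : AddSubgroup (geomTorsion W N),
        (∀ σ : absoluteGaloisGroup F, ∀ S ∈ C, σ • S ∈ C) ∧
          IsCompl C (AddSubgroup.zmultiples P)) ↔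
      ∀ τ : absoluteGaloisGroup F, modPCyclotomicCharacterZMod F N τ = 1 →
        ∀ S : geomTorsion W N, τ • S = S := by
  have hN : N.Prime := Fact.out
  haveI : NeZero N := ⟨hN.ne_zero⟩
  letI : Module (ZMod N) (geomTorsion W N) := AddSubgroup.torsionBy.zmodModule
  -- `σ` fixes every multiple of `P`
  have hPz : ∀ (σ : absoluteGaloisGroup F) (k : ℤ), σ • (k • P) = k • P := fun σ k ↦ by
    rw [← DistribMulAction.toAddMonoidHom_apply, map_zsmul, DistribMulAction.toAddMonoidHom_apply,
      hP]
  have hPn : ∀ (σ : absoluteGaloisGroup F) (k : ℕ), σ • (k • P) = k • P := fun σ k ↦ by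
    rw [← DistribMulAction.toAddMonoidHom_apply, map_nsmul, DistribMulAction.toAddMonoidHom_apply,
      hP]
  have hcomm : ∀ (σ : absoluteGaloisGroup F) (k : ℕ) (S : geomTorsion W N),
      σ • (k • S) = k • (σ • S) := fun σ k S ↦ by
    rw [← DistribMulAction.toAddMonoidHom_apply, map_nsmul, DistribMulAction.toAddMonoidHom_apply]
  constructor
  · -- (⇒)
    rintro ⟨C, hC, hcompl⟩ τ hτ S
    have hS : S ∈ C ⊔ AddSubgroup.zmultiples P := by rw [hcompl.sup_eq_top]; trivial
    obtain ⟨c, hc, z, hz, rfl⟩ := AddSubgroup.mem_sup.mp hS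
    obtain ⟨k, rfl⟩ := AddSubgroup.mem_zmultiples_iff.mp hz
    have hτc : τ • c = c := by
      have h1 : τ • c - c ∈ AddSubgroup.zmultiples P := by
        have h := smul_sub_cyclotomic_smul_mem_zmultiples W N hP0 hP τ c
        rwa [hτ, Units.val_one, ZMod.val_one, one_smul] at h
      have h2 : τ • c - c ∈ C := C.sub_mem (hC τ c hc) hc
      have h3 : τ • c - c ∈ C ⊓ AddSubgroup.zmultiples P := AddSubgroup.mem_inf.mpr ⟨h2, h1⟩
      rw [hcompl.inf_eq_bot, AddSubgroup.mem_bot] at h3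
      exact sub_eq_zero.mp h3
    rw [smul_add, hτc, hPz]
  · -- (⇐)
    intro htriv
    -- the range of `χ̄` is a finite subgroup of `𝔽_N^×`, hence cyclic: a generator `χ̄ σ₀`
    obtain ⟨g, hg⟩ := IsCyclic.exists_generator (α := (modPCyclotomicCharacterZMod F N).range)
    obtain ⟨σ₀, hσ₀⟩ := MonoidHom.mem_range.mp g.2
    -- every `σ` acts on `E[N]` as a power of `σ₀`
    have hred : ∀ σ : absoluteGaloisGroup F, ∃ i : ℤ, ∀ S : geomTorsion W N,
        σ • S = (σ₀ ^ i) • S := by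
      intro σ
      obtain ⟨i, hi⟩ := Subgroup.mem_zpowers_iff.mp (hg ⟨modPCyclotomicCharacterZMod F N σ, σ, rfl⟩)
      have hi' : modPCyclotomicCharacterZMod F N σ₀ ^ i = modPCyclotomicCharacterZMod F N σ := by
        have h := congrArg Subtype.val hi
        rwa [SubgroupClass.coe_zpow, ← hσ₀] at h
      refine ⟨i, fun S ↦ ?_⟩
      have hτ : modPCyclotomicCharacterZMod F N (σ * (σ₀ ^ i)⁻¹) = 1 := by
        rw [map_mul, map_inv, map_zpow, hi', mul_inv_cancel]
      have h := htriv _ hτ ((σ₀ ^ i) • S)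
      rwa [mul_smul, inv_smul_smul] at h
    set d : ZMod N := ((modPCyclotomicCharacterZMod F N σ₀ : (ZMod N)ˣ) : ZMod N) with hd
    obtain ⟨e, heP⟩ := exists_addEquiv_apply_eq_single W N hP0
    by_cases hd1 : d = 1
    · -- `χ̄` is trivial on `Γ_F`, which then acts trivially: any complement of the line will do
      have hall : ∀ (σ : absoluteGaloisGroup F) (S : geomTorsion W N), σ • S = S := by
        intro σ S
        obtain ⟨i, hi⟩ := hred σ
        rw [hi]
        refine htriv _ ?_ S
        have hu : modPCyclotomicCharacterZMod F N σ₀ = 1 := by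
          rw [hd] at hd1
          exact Units.val_eq_one.mp hd1
        rw [map_zpow, hu, one_zpow]
      refine ⟨((Pi.evalAddMonoidHom (fun _ : Fin 2 ↦ ZMod N) 0).comp e.toAddMonoidHom).ker,
        fun σ S hS ↦ by rw [hall]; exact hS, ?_⟩
      rw [isCompl_iff, disjoint_iff, codisjoint_iff]
      constructor
      · rw [eq_bot_iff]
        intro S hS'
        obtain ⟨hS, hSP⟩ := AddSubgroup.mem_inf.mp hS'
        obtain ⟨k, rfl⟩ := AddSubgroup.mem_zmultiples_iff.mp hSP
        rw [AddMonoidHom.mem_ker, AddMonoidHom.coe_comp, Function.comp_apply,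
          AddEquiv.coe_toAddMonoidHom, map_zsmul, heP, Pi.evalAddMonoidHom_apply, Pi.smul_apply,
          Pi.single_eq_same, zsmul_eq_mul, mul_one] at hS
        rw [AddSubgroup.mem_bot, ← Int.cast_smul_eq_zsmul (ZMod N), hS, zero_smul]
      · rw [eq_top_iff]
        intro S _
        rw [AddSubgroup.mem_sup]
        refine ⟨S - (e S 0).val • P, ?_, (e S 0).val • P,
          AddSubgroup.mem_zmultiples_iff.mpr ⟨(e S 0).val, natCast_zsmul _ _⟩, sub_add_cancel _ _⟩
        rw [AddMonoidHom.mem_ker, AddMonoidHom.coe_comp, Function.comp_apply,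
          AddEquiv.coe_toAddMonoidHom, map_sub, map_nsmul, heP, Pi.evalAddMonoidHom_apply,
          Pi.sub_apply, Pi.smul_apply, Pi.single_eq_same, nsmul_eq_mul, mul_one,
          ZMod.natCast_zmod_val, sub_self]
    · -- `d ≠ 1`: the `d`-eigenspace of `σ₀`
      let C : AddSubgroup (geomTorsion W N) :=
        { carrier := {S | σ₀ • S = d.val • S}
          add_mem' := fun {a b} ha hb ↦ by
            simp only [Set.mem_setOf_eq] at ha hb ⊢
            rw [smul_add, ha, hb, nsmul_add]
          zero_mem' := by simp
          neg_mem' := fun {a} ha ↦ by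
            simp only [Set.mem_setOf_eq] at ha ⊢
            rw [smul_neg, ha, smul_neg] }
      have hmemC : ∀ S, S ∈ C ↔ σ₀ • S = d.val • S := fun S ↦ Iff.rfl
      have hσ₀ : ∀ S ∈ C, σ₀ • S ∈ C := by
        intro S hS
        rw [hmemC] at hS ⊢
        rw [hS, hcomm, hS]
      have hσ₀inv : ∀ S ∈ C, σ₀⁻¹ • S ∈ C := by
        intro S hS
        rw [hmemC] at hS ⊢
        rw [smul_inv_smul]
        calc S = σ₀⁻¹ • (σ₀ • S) := (inv_smul_smul σ₀ S).symm
          _ = d.val • (σ₀⁻¹ • S) := by rw [hS, hcomm]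
      have hzpow : ∀ (i : ℤ), ∀ S ∈ C, (σ₀ ^ i) • S ∈ C := by
        intro i
        induction i using Int.induction_on with
        | zero => intro S hS; simpa using hS
        | succ i ih => intro S hS; rw [zpow_add_one, mul_smul]; exact ih _ (hσ₀ S hS)
        | pred i ih => intro S hS; rw [zpow_sub_one, mul_smul]; exact ih _ (hσ₀inv S hS)
      have hstab : ∀ σ : absoluteGaloisGroup F, ∀ S ∈ C, σ • S ∈ C := by
        intro σ S hS
        obtain ⟨i, hi⟩ := hred σ
        rw [hi]
        exact hzpow i S hS
      refine ⟨C, hstab, ?_⟩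
      have hd1' : (d - 1 : ZMod N) ≠ 0 := sub_ne_zero.mpr hd1
      have h1d : (1 - d : ZMod N) ≠ 0 := sub_ne_zero.mpr (Ne.symm hd1)
      rw [isCompl_iff, disjoint_iff, codisjoint_iff]
      constructor
      · rw [eq_bot_iff]
        intro S hS'
        obtain ⟨hS, hSP⟩ := AddSubgroup.mem_inf.mp hS'
        rw [hmemC] at hS
        obtain ⟨k, rfl⟩ := AddSubgroup.mem_zmultiples_iff.mp hSP
        rw [hPz] at hS
        have h : (d - 1) • (k • P) = 0 := by
          rw [sub_smul, one_smul, ← Nat.cast_smul_eq_nsmul (ZMod N) d.val, ZMod.natCast_zmod_val]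
            at *
          rw [← hS, sub_self]
        rw [AddSubgroup.mem_bot]
        exact (smul_eq_zero.mp h).resolve_left hd1'
      · rw [eq_top_iff]
        intro S _
        obtain ⟨k, hk⟩ := AddSubgroup.mem_zmultiples_iff.mp
          (smul_sub_cyclotomic_smul_mem_zmultiples W N hP0 hP σ₀ S)
        set c : ZMod N := (k : ZMod N) * (1 - d)⁻¹ with hc
        rw [AddSubgroup.mem_sup]
        refine ⟨S - c.val • P, ?_, c.val • P,
          AddSubgroup.mem_zmultiples_iff.mpr ⟨c.val, natCast_zsmul _ _⟩, sub_add_cancel _ _⟩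
        rw [hmemC]
        have hσS : σ₀ • S = d.val • S + k • P := by rw [hk]; abel
        rw [smul_sub, hσS, hPn, ← Nat.cast_smul_eq_nsmul (ZMod N) d.val,
          ← Nat.cast_smul_eq_nsmul (ZMod N) d.val, ← Nat.cast_smul_eq_nsmul (ZMod N) c.val,
          ← Int.cast_smul_eq_zsmul (ZMod N) k, ZMod.natCast_zmod_val, ZMod.natCast_zmod_val]
        have hkc : (k : ZMod N) = c * (1 - d) := by
          rw [hc, mul_assoc, inv_mul_cancel₀ h1d, mul_one]
        rw [hkc]
        module

end Structure

/-! ## §3 Over `ℚ`: the putative curve "`ℤ/N ⊂ E`" of Mazur's proof -/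

section Rat

variable (W : WeierstrassCurve ℚ) [W.IsElliptic]

omit [W.IsElliptic] in
/-- **The geometric point of a rational point of prime order `N`** lies in `E[N] = E(ℚ̄)[N]`, is
non-zero and is fixed by `Γ_ℚ` (Mazur, p. 157: "`ℤ/N_{/S} ⊂ E_{/S}` is the étale constant
subgroup scheme over `S` generated by our point of order `N`"; here on geometric points: the
image of `P` under `E(ℚ) → E(ℚ̄)`, Mathlib's `Affine.Point.map` along `ℚ → ℚ̄`).
[cite: Mazur1977, Ch. III §5, p. 157] -/
theorem exists_geomTorsion_of_addOrderOf_eq {N : ℕ} [Fact N.Prime] {P : W.toAffine.Point}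
    (hP : addOrderOf P = N) :
    ∃ Pb : geomTorsion W N,
      (Pb : geomPoints W) = Affine.Point.map (W' := W.toAffine) (S := ℚ)
        (Algebra.ofId ℚ (AlgebraicClosure ℚ)) P ∧
      Pb ≠ 0 ∧ ∀ σ : absoluteGaloisGroup ℚ, σ • Pb = Pb := by
  have hN : N.Prime := Fact.out
  set ι : W.toAffine.Point →+ geomPoints W :=
    Affine.Point.map (W' := W.toAffine) (S := ℚ) (Algebra.ofId ℚ (AlgebraicClosure ℚ)) with hι
  have hinj : Function.Injective ι :=
    Affine.Point.map_injective (W' := W.toAffine) (f := Algebra.ofId ℚ (AlgebraicClosure ℚ))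
  have hNP : (N : ℤ) • P = 0 := by rw [natCast_zsmul, ← hP]; exact addOrderOf_nsmul_eq_zero P
  have hmem : ι P ∈ geomTorsion W N := by
    rw [mem_torsionBy_iff, ← map_zsmul, hNP, map_zero]
  refine ⟨⟨ι P, hmem⟩, rfl, fun h0 ↦ ?_, fun σ ↦ Subtype.ext ?_⟩
  · have h : ι P = ι 0 := by rw [map_zero]; exact congrArg Subtype.val h0
    have hP0 : P = 0 := hinj h
    rw [hP0, addOrderOf_zero] at hP
    exact hN.one_lt.ne hP
  · let σ' : AlgebraicClosure ℚ ≃ₐ[ℚ] AlgebraicClosure ℚ := σ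
    have h1 := Affine.Point.map_map (W' := W.toAffine) (S := ℚ)
      (Algebra.ofId ℚ (AlgebraicClosure ℚ)) (σ' : AlgebraicClosure ℚ →ₐ[ℚ] AlgebraicClosure ℚ) P
    have h2 : (σ' : AlgebraicClosure ℚ →ₐ[ℚ] AlgebraicClosure ℚ).comp
        (Algebra.ofId ℚ (AlgebraicClosure ℚ)) = Algebra.ofId ℚ (AlgebraicClosure ℚ) :=
      Subsingleton.elim _ _
    rw [h2] at h1
    exact h1

/-- **Mazur 1977, Ch. III §5, p. 157, for the curve "`ℤ/N ⊂ E`": the structure of `E[N]`**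
(the first paragraph of the proof of the prime case and its two displays). For an elliptic curve
`E/ℚ` with a rational point `P` of prime order `N`, writing `P̄ ∈ E[N]` for its geometric point
and `χ̄ = χ̄_N` for the mod-`N` cyclotomic character of `Γ_ℚ`:
(i) `P̄ ≠ O` is `Γ_ℚ`-fixed ("`ℤ/N ⊂ E[N]`");
(ii) (5.4) `0 → ℤ/N → E[N] → μ_N → 0`: `σ S - χ̄(σ) S ∈ ⟨P̄⟩` for all `σ ∈ Γ_ℚ`, `S ∈ E[N]`
("a faithful representation into `GL₂(𝔽_N)` of the form `(1 *; 0 χ)`");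
(iii) for `τ ∈ Γ_K` (`χ̄(τ) = 1`, `K = ℚ(ζ_N)`) and `σ ∈ Γ_ℚ`:
`(σ τ σ⁻¹) S - S = χ̄(σ)⁻¹ (τ S - S)` ("the natural action of `Gal(K/ℚ)` on `Gal(L/K)` … is by
multiplication by `χ⁻¹`"). The splitting criterion "(5.4) splits iff `L = K`" is
`Mazur1977_splits_iff` below; the Second reduction itself (Shafarevich / Thm. (4.1), no CM over
`ℚ`) is not formalised here.
[cite: Mazur1977, Ch. III §5, p. 157 ((5.4), the Borel shape, the χ⁻¹-action)] -/
theorem Mazur1977_torsion_galoisModule {N : ℕ} [Fact N.Prime] {P : W.toAffine.Point}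
    (hP : addOrderOf P = N) :
    ∃ Pb : geomTorsion W N,
      (Pb : geomPoints W) = Affine.Point.map (W' := W.toAffine) (S := ℚ)
        (Algebra.ofId ℚ (AlgebraicClosure ℚ)) P ∧
      Pb ≠ 0 ∧ (∀ σ : absoluteGaloisGroup ℚ, σ • Pb = Pb) ∧
      (∀ (σ : absoluteGaloisGroup ℚ) (S : geomTorsion W N),
        σ • S - ((modPCyclotomicCharacterZMod ℚ N σ : (ZMod N)ˣ) : ZMod N).val • S ∈
          AddSubgroup.zmultiples Pb) ∧
      ∀ (τ : absoluteGaloisGroup ℚ), modPCyclotomicCharacterZMod ℚ N τ = 1 →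
        ∀ (σ : absoluteGaloisGroup ℚ) (S : geomTorsion W N),
          (σ * τ * σ⁻¹) • S - S =
            (((modPCyclotomicCharacterZMod ℚ N σ)⁻¹ : (ZMod N)ˣ) : ZMod N).val • (τ • S - S) := by
  have hN : N.Prime := Fact.out
  haveI : NeZero (N : ℚ) := ⟨Nat.cast_ne_zero.mpr hN.ne_zero⟩
  obtain ⟨Pb, hPb, hPb0, hfix⟩ := exists_geomTorsion_of_addOrderOf_eq W hP
  exact ⟨Pb, hPb, hPb0, hfix,
    fun σ S ↦ smul_sub_cyclotomic_smul_mem_zmultiples W N hPb0 hfix σ S,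
    fun τ hτ σ S ↦ conj_smul_sub_eq_cyclotomic_inv_smul W N hPb0 hfix hτ σ S⟩

/-- **`ρ̄_{E,N}` is reducible for an elliptic curve over `ℚ` with a rational point of prime order
`N`** (the Borel shape `(1 *; 0 χ)` of Mazur, p. 157; in the tree's vocabulary
`WeierstrassCurve.HasIrreducibleModPGaloisRep`: the line `⟨P̄⟩` is `Γ_ℚ`-stable, `≠ ⊥, ⊤`).
[cite: Mazur1977, Ch. III §5, p. 157 (display after (5.4))] -/
theorem not_hasIrreducibleModPGaloisRep_of_addOrderOf_eq {N : ℕ} [Fact N.Prime]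
    {P : W.toAffine.Point} (hP : addOrderOf P = N) : ¬ W.HasIrreducibleModPGaloisRep N := by
  have hN : N.Prime := Fact.out
  haveI : NeZero (N : ℚ) := ⟨Nat.cast_ne_zero.mpr hN.ne_zero⟩
  obtain ⟨Pb, -, hPb0, hfix⟩ := exists_geomTorsion_of_addOrderOf_eq W hP
  exact not_hasIrreducibleModPGaloisRep_of_smul_eq W N hPb0 hfix

/-- **In the scope of the prime-case leaf**: if `Mazur1977_no_prime_torsion W` failed at a prime
`N ∉ {2, 3, 5, 7, 13}`, i.e. `E(ℚ)` had a point of order `N`, then `ρ̄_{E,N}` would be reducible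
of the shape `(1 *; 0 χ̄_N)` — the starting point of Mazur's three reductions (p. 157).
Contrapositive form: an elliptic curve over `ℚ` whose mod-`N` representation is irreducible has
no rational point of order `N`. [cite: Mazur1977, Ch. III §5, p. 157] -/
theorem not_exists_addOrderOf_eq_of_hasIrreducibleModPGaloisRep {N : ℕ} [Fact N.Prime]
    (h : W.HasIrreducibleModPGaloisRep N) : ¬ ∃ P : W.toAffine.Point, addOrderOf P = N :=
  fun ⟨_, hP⟩ ↦ not_hasIrreducibleModPGaloisRep_of_addOrderOf_eq W hP h

/-- **"(5.4) splits if and only if `L = K`" for the curve "`ℤ/N ⊂ E`" over `ℚ`** (Mazur, p. 157;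
the Second reduction then reads "It suffices to prove that (5.4) splits, or equivalent, that
`L = K`"): for an elliptic curve `E/ℚ` with a rational point `P` of prime order `N` and its
geometric point `P̄ ∈ E[N]`, the line `⟨P̄⟩` has a `Γ_ℚ`-stable complement in `E[N]` iff every
`τ ∈ Γ_ℚ` with `χ̄_N(τ) = 1` (i.e. `τ ∈ Γ_K`, `K = ℚ(ζ_N)`) acts trivially on `E[N]` (i.e.
`L = ℚ(E[N]) ⊆ K`). [cite: Mazur1977, Ch. III §5, p. 157] -/
theorem Mazur1977_splits_iff {N : ℕ} [Fact N.Prime] {P : W.toAffine.Point}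
    (hP : addOrderOf P = N) {Pb : geomTorsion W N}
    (hPb : (Pb : geomPoints W) = Affine.Point.map (W' := W.toAffine) (S := ℚ)
      (Algebra.ofId ℚ (AlgebraicClosure ℚ)) P) :
    (∃ C : AddSubgroup (geomTorsion W N),
        (∀ σ : absoluteGaloisGroup ℚ, ∀ S ∈ C, σ • S ∈ C) ∧
          IsCompl C (AddSubgroup.zmultiples Pb)) ↔
      ∀ τ : absoluteGaloisGroup ℚ, modPCyclotomicCharacterZMod ℚ N τ = 1 →
        ∀ S : geomTorsion W N, τ • S = S := by
  have hN : N.Prime := Fact.out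
  haveI : NeZero (N : ℚ) := ⟨Nat.cast_ne_zero.mpr hN.ne_zero⟩
  obtain ⟨Pb', hPb', hPb0, hfix⟩ := exists_geomTorsion_of_addOrderOf_eq W hP
  have he : Pb = Pb' := Subtype.ext (hPb.trans hPb'.symm)
  subst he
  exact exists_stable_isCompl_zmultiples_iff W N hPb0 hfix

end Rat

end Literature.NumberTheory.EllipticCurves

end
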